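import Summits.NavierStokesRegularity.NavierStokesRegularity.Theorems.ScenarioCensusRowF1ax
import Literature.Analysis.FluidPDE.BarkerPrange2020VorticityAlignmentTypeIHolds
import Literature.Analysis.FluidPDE.TypeIAncientMildTimeAnalytic
import HarnessLib
import Summits.NavierStokesRegularity.NavierStokesRegularity.Theorems.ScenarioCensusRowF1ColumnarTop

/-!
# Census row F1, TIME-LAG INCIDENCE ON THE TYPE-I TOP — the 2×2 table of TWO-TIME criteria (cells F1dj / F1gl / F1ge / F1de; floors PT «persistent tops» / TTF) — LINE 34
# «two-time-top» port, part 1/4: §1 the lagged time, the top, the four two-time read-outs; rows, floors, residual `PersistenceCollapse` (≡ `Row_F1`), split; §2 the singular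
# Type-I zoom package with gradients and the zoom bookkeeping (LINE 15 / 33 VERBATIM — BY NAME `ColumnarTop.…` / `SymmetricTop.eventually_top`)

Re-homed for the scenario census (typer seat ns-census-typer-1 g9; the cells F1dj / F1gl / F1ge / F1de and the floors are MEMBERS OF RECORD «DECIDED IN KERNEL IN FILES» of row
F1 since census v1.100 (item 70: critic PASS; ref ns-census-ref g13 PRE-CHECK ✓ §18.6; lead-presearch label); this port makes them TREE-decided): VERBATIM PORT of
ns-idea-3 LINE 34 «two-time-top», `pub/ideators/ns-idea-3/lines/two-time-top/line-two-time-top.lean` sha16 26867eeb269186b0 (1077 l., lean check rc 0, 0 sorry), split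
for the 400-line rule into `ScenarioCensusRowF1TwoTimeTop` (§1–§2) → `…TwoTimeTopSignals` (§3) → `…TwoTimeTopTransfer` (§4) → `…TwoTimeTopRows` (§5–§6 + census KEYS).
Lean text VERBATIM in namespace `…Theorems.ScenarioCensus.TwoTimeTop` (the line's `…Cruxes.ScenarioCensusRowF1.TwoTimeTopLine` re-homed); port edits: §2's zoom package /
`tendsto_physicalTime` / `eventually_top` (LINES 15/33 VERBATIM) are taken BY NAME from the landed columnar-top / symmetric-top ports; `@[conjecture]` on the residual
`PersistenceCollapse` (≡ `ScenarioCensus.Row_F1`, OPEN); docstrings complete.  Statements untouched.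

No census VALUE is moved here (row F1 stays OPEN-WITH-LINE; the members become TREE-decided by name); NS regularity is NOT proved; `Row_F1` is untouched (zero
movement, `persistenceCollapse_iff_rowF1`); no summit statement is proved by this file. Lemmas that restate already-landed tree declarations are taken BY NAME (gate lint `dedup.landed`): `exists_singularZoom_package` = `ColumnarTop.exists_singularZoom_package`, `tendsto_physicalTime` = `ColumnarTop.tendsto_physicalTime`, `eventually_top` = `SymmetricTop.eventually_top`.
-/

-- the summit and its single problem share the name `NavierStokesRegularity` (D-0017 nested layout)
set_option linter.dupNamespace false

noncomputable section

open MeasureTheory Set Function Filter TopologicalSpace Metric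
open scoped Topology NNReal ENNReal

namespace Summit.NavierStokesRegularity.NavierStokesRegularity.Theorems.ScenarioCensus.TwoTimeTop

open Literature.Analysis Literature.Analysis.FluidPDE
open Summit.NavierStokesRegularity.NavierStokesRegularity.Theorems
open Summit.NavierStokesRegularity.NavierStokesRegularity.Theses

/-- `ℝ³`. -/
abbrev E3 := EuclideanSpace ℝ (Fin 3)

/-! ## §1 The lagged time, the top, the four TWO-TIME read-outs; rows, floors, residual, split -/

/-- The **lagged time** `t − θ(T − t)`: the instant a fixed fraction `θ` of the remaining life-span earlier;
`T − lagTime T θ t = (1 + θ)(T − t)`. -/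
def lagTime (T θ t : ℝ) : ℝ := t - θ * (T - t)

/-- `T − lagTime T θ t = (1 + θ)(T − t)`. -/
theorem sub_lagTime (T θ t : ℝ) : T - lagTime T θ t = (1 + θ) * (T - t) := by
  unfold lagTime; ring

/-- The lagged time is earlier. -/
theorem lagTime_lt (T θ t : ℝ) (hθ : 0 < θ) (ht : t < T) : lagTime T θ t < t := by
  unfold lagTime; nlinarith

/-- The lag is covariant under the parabolic rescaling of time about `T` (`t ↦ T + λ²(t − T)`) and under the choice
of `T` as origin: it is a fixed number `log (1+θ)` of e-folds of the remaining life-span. -/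
theorem lagTime_rescale (T θ t l : ℝ) : lagTime T θ (T + l * (t - T)) = T + l * (lagTime T θ t - T) := by
  unfold lagTime; ring

/-- The **top of level `Λ`** at time `t`: the points where the dimensionless speed `√(T − t)|u|/√ν` is at least `Λ`. -/
def topSet (ν T : ℝ) (u : ℝ → E3 → E3) (Λ t : ℝ) : Set E3 :=
  {x | Λ * Real.sqrt ν ≤ Real.sqrt (T - t) * ‖u t x‖}

/-- Membership in the top set. -/
theorem mem_topSet {ν T : ℝ} {u : ℝ → E3 → E3} {Λ t : ℝ} {x : E3} :
    x ∈ topSet ν T u Λ t ↔ Λ * Real.sqrt ν ≤ Real.sqrt (T - t) * ‖u t x‖ := Iff.rfl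

/-- The tops are nested: a point of the `Λ'`-top is on every lower top. -/
theorem mem_topSet_of_le {ν T : ℝ} {u : ℝ → E3 → E3} {Λ Λ' t : ℝ} {x : E3} (hν : 0 ≤ Real.sqrt ν)
    (hle : Λ ≤ Λ') (hx : x ∈ topSet ν T u Λ' t) : x ∈ topSet ν T u Λ t :=
  (mul_le_mul_of_nonneg_right hle hν).trans hx

/-- **(DJ) DISJOINT TOPS** with lag `θ`: on every level `Λ`, eventually, no point is `Λ`-fast BOTH at time `t` and at
the lagged time `t − θ(T − t)` — the top renews itself completely over every lag. -/
def HasDisjointTops (ν T θ : ℝ) (u : ℝ → E3 → E3) : Prop :=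
  ∀ Λ : ℝ, 0 < Λ → ∀ᶠ t in 𝓝[<] T, Disjoint (topSet ν T u Λ (lagTime T θ t)) (topSet ν T u Λ t)

/-- **(GL) SUPER-SELF-SIMILAR GROWTH, late anchor** (lag `θ`, ratio `q`): on the top of every level, eventually,
the dimensionless speed at the SAME point one lag earlier was at most `q` times the current one:
`√(T − t')|u(t', x)| ≤ q √(T − t)|u(t, x)|`, `t' = t − θ(T − t)`, i.e. `√(1+θ)|u(t', x)| ≤ q |u(t, x)|`.  For
`q < 1` the pointwise growth over the lag beats the self-similar factor `√(1+θ)`. -/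
def HasLateGrowth (ν T θ q : ℝ) (u : ℝ → E3 → E3) : Prop :=
  ∀ Λ : ℝ, 0 < Λ → ∀ᶠ t in 𝓝[<] T, ∀ x ∈ topSet ν T u Λ t,
    Real.sqrt (1 + θ) * ‖u (lagTime T θ t) x‖ ≤ q * ‖u t x‖

/-- **(GE) SUPER-SELF-SIMILAR GROWTH, early anchor**: the same inequality, demanded at the points which were `Λ`-fast
at the EARLIER time (every early-fast point has escalated by the late time). -/
def HasEarlyGrowth (ν T θ q : ℝ) (u : ℝ → E3 → E3) : Prop :=
  ∀ Λ : ℝ, 0 < Λ → ∀ᶠ t in 𝓝[<] T, ∀ x ∈ topSet ν T u Λ (lagTime T θ t),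
    Real.sqrt (1 + θ) * ‖u (lagTime T θ t) x‖ ≤ q * ‖u t x‖

/-- **(DE) FAST DIMMING, early anchor** (lag `θ`, ratio `q`): every point that was `Λ`-fast one lag earlier has, by
now, a dimensionless speed at most `q` times its earlier one: `√(T − t)|u(t, x)| ≤ q √(T − t')|u(t', x)|`, i.e.
`|u(t, x)| ≤ q √(1+θ) |u(t', x)|` (for `q √(1+θ) ≥ 1` this still allows pointwise GROWTH, below the self-similar
rate). -/
def HasEarlyDecay (ν T θ q : ℝ) (u : ℝ → E3 → E3) : Prop :=
  ∀ Λ : ℝ, 0 < Λ → ∀ᶠ t in 𝓝[<] T, ∀ x ∈ topSet ν T u Λ (lagTime T θ t),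
    ‖u t x‖ ≤ q * Real.sqrt (1 + θ) * ‖u (lagTime T θ t) x‖

/-- **Criterion row F1dj** (Type I · DISJOINT TOPS for some lag · Clay ⇒ extension): the frame of
`ScenarioCensus.Row_F1` verbatim plus `∃ θ > 0, HasDisjointTops ν T θ u`.  PROVED (`rowF1dj_holds`). -/
def Row_F1dj : Prop :=
  ∀ (ν T : ℝ), 0 < ν → 0 < T →
    ∀ (u : ℝ → E3 → E3) (p : ℝ → E3 → ℝ),
    IsClassicalNSSolutionOn (Ico 0 T) ν 0 u p → IsLerayHopfOn T ν 0 (u 0) u →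
    HasRapidSpatialDecay (u 0) → IsTypeIBlowup u T → (∃ θ : ℝ, 0 < θ ∧ HasDisjointTops ν T θ u) →
    HasSmoothExtensionPast ν 0 u T

/-- **Criterion row F1gl** (Type I · super-self-similar pointwise growth on the top, late anchor, some lag `θ > 0`
and ratio `q < 1` · Clay ⇒ extension).  PROVED (`rowF1gl_holds`). -/
def Row_F1gl : Prop :=
  ∀ (ν T : ℝ), 0 < ν → 0 < T →
    ∀ (u : ℝ → E3 → E3) (p : ℝ → E3 → ℝ),
    IsClassicalNSSolutionOn (Ico 0 T) ν 0 u p → IsLerayHopfOn T ν 0 (u 0) u →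
    HasRapidSpatialDecay (u 0) → IsTypeIBlowup u T →
    (∃ θ q : ℝ, 0 < θ ∧ q < 1 ∧ HasLateGrowth ν T θ q u) →
    HasSmoothExtensionPast ν 0 u T

/-- **Row F1ge — the CLASSICAL cell, re-derived** (Type I · super-self-similar growth, EARLY anchor · Clay ⇒ extension).
PROVED here by ENGINE A (`rowF1ge_holds`) as a consistency check, but NOT claimed as content: anchored at the EARLIER time, the
inequality can be evaluated at a near-maximum point of `|u(t′,·)|` (which is on the top by Leray's necessary rate, tree ns.S28
`leray_blowup_rate_top_holds`) and becomes the sup-norm growth law `M(t) ≥ √(1+θ)q⁻¹·M(t′)(1−η)`, which contradicts the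
Type-I bound after finitely many lags — an elementary argument (not typed here).  The same holds for the fourth cell «late-anchored
dimming» (`M(t) ≤ q√(1+θ)M(t′)` against Leray's rate), which is not even stated.  The two cells anchored at the time of the LARGER
side of the inequality (`Row_F1gl`, `Row_F1de`) admit no such evaluation (a fresh flare elsewhere is allowed) and are the rows of
record, with the level form `Row_F1dj`. -/
def Row_F1ge : Prop :=
  ∀ (ν T : ℝ), 0 < ν → 0 < T →
    ∀ (u : ℝ → E3 → E3) (p : ℝ → E3 → ℝ),
    IsClassicalNSSolutionOn (Ico 0 T) ν 0 u p → IsLerayHopfOn T ν 0 (u 0) u →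
    HasRapidSpatialDecay (u 0) → IsTypeIBlowup u T →
    (∃ θ q : ℝ, 0 < θ ∧ q < 1 ∧ HasEarlyGrowth ν T θ q u) →
    HasSmoothExtensionPast ν 0 u T

/-- **Criterion row F1de** (Type I · fast dimming of every early-fast point, some lag `θ > 0`, ratio `q < 1` · Clay
⇒ extension).  PROVED (`rowF1de_holds`).  Its late-anchored twin («the current top was faster before, by the factor
`q√(1+θ)`») is the ELEMENTARY cell of the table (Leray's rate at the maximum point) and is not an item. -/
def Row_F1de : Prop :=
  ∀ (ν T : ℝ), 0 < ν → 0 < T →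
    ∀ (u : ℝ → E3 → E3) (p : ℝ → E3 → ℝ),
    IsClassicalNSSolutionOn (Ico 0 T) ν 0 u p → IsLerayHopfOn T ν 0 (u 0) u →
    HasRapidSpatialDecay (u 0) → IsTypeIBlowup u T →
    (∃ θ q : ℝ, 0 < θ ∧ q < 1 ∧ HasEarlyDecay ν T θ q u) →
    HasSmoothExtensionPast ν 0 u T

/-- **PERSISTENT TOPS** (structural floor, maximal frame): at a maximal Type-I Clay blow-up, for EVERY lag `θ > 0`
some level `Λ` sees, at times arbitrarily close to `T`, a point which is `Λ`-fast at `t − θ(T − t)` AND at `t`.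
PROVED (`persistentTops_holds`, display `persistentTops_unfolded`). -/
def PersistentTops : Prop :=
  ∀ (ν T : ℝ), 0 < ν → 0 < T →
    ∀ (u : ℝ → E3 → E3) (p : ℝ → E3 → ℝ),
    IsMaximalSmoothSolution ν 0 u p T → IsLerayHopfOn T ν 0 (u 0) u →
    HasRapidSpatialDecay (u 0) → IsTypeIBlowup u T →
    ∀ θ : ℝ, 0 < θ → ¬ HasDisjointTops ν T θ u

/-- **TWO-TIME FLOOR** (structural, maximal frame): at a maximal Type-I Clay blow-up, for every lag `θ > 0` and every
ratio `q < 1`, none of (GL), (GE), (DE) holds: on some level, at times arbitrarily close to `T`, some fast point has grown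
over the lag by LESS than the factor `q⁻¹√(1+θ)⁻¹·(1+θ) = √(1+θ)/q` (display `twoTimeFloor_gl_unfolded`), and some early-fast
point has NOT dimmed to `q√(1+θ)` times its earlier speed.  PROVED (`twoTimeFloor_holds`). -/
def TwoTimeFloor : Prop :=
  ∀ (ν T : ℝ), 0 < ν → 0 < T →
    ∀ (u : ℝ → E3 → E3) (p : ℝ → E3 → ℝ),
    IsMaximalSmoothSolution ν 0 u p T → IsLerayHopfOn T ν 0 (u 0) u →
    HasRapidSpatialDecay (u 0) → IsTypeIBlowup u T →
    ∀ θ q : ℝ, 0 < θ → q < 1 →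
      ¬ HasLateGrowth ν T θ q u ∧ ¬ HasEarlyGrowth ν T θ q u ∧ ¬ HasEarlyDecay ν T θ q u

/-- **Residual** (maximal frame): every maximal Type-I Clay blow-up has disjoint tops for some lag.  DECLARED ≡ row F1
(`persistenceCollapse_iff_rowF1`); no movement on `Row_F1` is claimed.  (The residuals of the three ratio rows are
the analogous statements and are likewise ≡ row F1.) -/
@[conjecture] def PersistenceCollapse : Prop :=
  ∀ (ν T : ℝ), 0 < ν → 0 < T →
    ∀ (u : ℝ → E3 → E3) (p : ℝ → E3 → ℝ),
    IsMaximalSmoothSolution ν 0 u p T → IsLerayHopfOn T ν 0 (u 0) u →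
    HasRapidSpatialDecay (u 0) → IsTypeIBlowup u T → ∃ θ : ℝ, 0 < θ ∧ HasDisjointTops ν T θ u

/-- **The split**: criterion + residual ⇒ row F1 (by cases on extendability). -/
theorem rowF1_of (hD : Row_F1dj) (hR : PersistenceCollapse) : ScenarioCensus.Row_F1 := by
  unfold ScenarioCensus.Row_F1
  intro ν T hν hT u p hsol hLH hdec hTI
  by_contra hext
  exact hext (hD ν T hν hT u p hsol hLH hdec hTI (hR ν T hν hT u p ⟨hsol, hext⟩ hLH hdec hTI))

/-- The residual is a consequence of the row (vacuously). -/
theorem persistenceCollapse_of_rowF1 (h : ScenarioCensus.Row_F1) : PersistenceCollapse :=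
  fun ν T hν hT u p hmax hLH hdec hTI => (hmax.2 (h ν T hν hT u p hmax.1 hLH hdec hTI)).elim

/-! ## §2 The singular Type-I zoom package with gradients (LINE 15 verbatim, as in LINES 31–33) -/

-- `exists_singularZoom_package`: the line restates the tree's `ColumnarTop.exists_singularZoom_package`; taken BY NAME (gate lint dedup.landed).

/-! ### Zoom bookkeeping at the Type-I scale (LINES 31–33 verbatim) -/

-- `tendsto_physicalTime`: the line restates the tree's `ColumnarTop.tendsto_physicalTime`; taken BY NAME (gate lint dedup.landed).

-- `eventually_top`: the line restates the tree's `SymmetricTop.eventually_top`; taken BY NAME (gate lint dedup.landed).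

end Summit.NavierStokesRegularity.NavierStokesRegularity.Theorems.ScenarioCensus.TwoTimeTop

end
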